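import Summits.BirchSwinnertonDyer.BirchSwinnertonDyer.Theorems.EisensteinPrimesUnramifiedOutsideRamification
import Literature.NumberTheory.IwasawaTheory.Greenberg2006.TwistDeformationLEO
import Literature.NumberTheory.IwasawaTheory.Greenberg2006.InducedCohomologyComparison
import Literature.NumberTheory.GaloisCohomology.PoitouTateRestrictedRamification
import Literature.NumberTheory.GaloisRepresentations.CohomologicalDimensionProofs
import HarnessLib

/-!
# Inflation `H¹(Gal(K_Σ/L), M) ≅ unramifiedOutside H M p S₀` and `cd_p Gal(K_Σ/L) ≤ 2`
# (cell `bsd-eis`, seat `bsd-line-x1-p1-w4` gen 4; crux 2 `GoodLatticeBDPValue` stmt-BirchSwinnertonDyer-19032, line `halves`,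
# V21 road S4 — transport file (B2))

HONEST FRAMING (cell `bsd-eis`, run/shared/lean/pub/bsd-eis/): Galois-cohomology plumbing for a number field `K` (no definition,
no named fact, no `sorry`, no `Theses` import); nothing about any curve is asserted; BSD / IMC2 / KY Thm. 1.4.1 are proved for NO
curve. Helper `--supports stmt-BirchSwinnertonDyer-19032`; closes no registered stub.

## What

Identification (I9) of the V21 road memo (`Cruxes/GoodLatticeBDPValue/Lines/halves-imprimLambda-index-road.md`), second half.
Setting: `Σ` a set of finite places of `K`, `G_{K,Σ} = Γ_K ⧸ N_Σ` (`GaloisGroupUnramifiedOutside K Σ`), `H ⊴ Γ_K` closed with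
`N_Σ ≤ H` (`L = K̄^H ⊆ K_Σ`), `𝔊 := galoisGroupAbove Σ H = Gal(K_Σ/L) ≤ G_{K,Σ}` (Greenberg 2006's group, tree
`IwasawaTheory/Greenberg2006`), and a discrete `Γ_K`-module `M` DESCENDED to `G_{K,Σ}`: a continuous representation
`ρ₀ : ContinuousRep (G_{K,Σ}) ℤ M` with `ρ₀ (σ mod N_Σ) m = σ • m` (so `N_Σ` acts trivially). Then:

* §1 `groupCdLE_two_galoisGroupAbove` — **`cd_p(𝔊) ≤ 2`** from the typed PUB fact
  `Literature.NumberTheory.GaloisCohomology.groupCdLE_two_galoisGroupUnramifiedOutside K` (Harari Cor. 17.14 = NSW (8.3.18)) and the closed-subgroup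
  theorem `groupCdLE_subgroup_of_isClosed_holds` (Serre I Prop. 14); `exists_continuousRep_quot` — every discrete `Γ_K`-module
  with continuous orbits on which `N_Σ` acts trivially descends to some `ρ₀`; `exists_hom_restrict` — equivariant maps descend.
* §2 THE INFLATION, cocycle level (`𝔊`-cocycles `φ` ↦ `h ↦ φ(h mod N_Σ)` on `H`): `exists_inflation` — there is an additive
  `infl : H¹(𝔊, M) →+ H¹(H, M)` with `infl [φ] = [ψ]` whenever `ψ(h) = φ(h̄)`; and for ANY such `infl`: it is injective
  (`inflation_injective`), its range is `ker(res_{N_Σ})` (`range_inflation_eq_ker_resOfLe`: a cocycle of `H` vanishing on `N_Σ`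
  descends CONTINUOUSLY to `𝔊`, `H ↠ 𝔊` being a quotient map from a compact group — the argument of
  `GreenbergFullAtSelmer.exists_cocycle_descent`, here for one closed `H`), hence = `unramifiedOutside H M p S₀` when
  `Σ = S₀ ∪ {w ∣ p}` (file (B1) `UnramifiedInflation.unramifiedOutside_eq_ker_resOfLe`); naturality in `M` (`inflation_natural`).
* §3 `exists_addEquiv_unramifiedOutside` — **`H¹(𝔊, M) ≃+ unramifiedOutside H M p S₀`**, characterised on cocycles, natural in `M`.

File (C) (next) combines this with `…EisensteinPrimesH2Bookkeeping` (p645763) to produce the `hH2` hypothesis of the LEAD's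
`ResidualIndexAssembly.zpCorank_datumStrictSelmer_add_eq` from weak Leopoldt + `cd_p ≤ 2`.

References: [SerreGaloisCohomology1997] I §2.6 (b) (inflation–restriction), I §3.3 Prop. 14; [NeukirchSchmidtWingberg2008] (1.6.7),
VIII §3, (8.3.18); [Harari2020] Cor. 17.14; [Greenberg2006] p. 342 (`H^i(K_Σ/K_∞, ·)`); [GreenbergVatsal2000] §2 pp. 16–17, 23.
-/

set_option autoImplicit false
set_option linter.dupNamespace false -- the summit namespace `…BirchSwinnertonDyer.BirchSwinnertonDyer.Theorems` (Sub = Summit, D-0017) trips it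

noncomputable section

open scoped Pointwise

namespace Summit.BirchSwinnertonDyer.BirchSwinnertonDyer.Theorems.UnramifiedInflation

open CategoryTheory Function NumberField IsDedekindDomain Field Topology
open Literature.NumberTheory.EllipticCurves Literature.NumberTheory.EllipticCurves.GreenbergSelmer
  Literature.NumberTheory.EllipticCurves.GreenbergVatsal2000 Literature.NumberTheory.GaloisRepresentations
  Literature.NumberTheory.IwasawaTheory.Greenberg2006

variable {K : Type} [Field K] [NumberField K]

/-! ## §1 `cd_p Gal(K_Σ/L) ≤ 2`; descent of modules and maps to `G_{K,Σ}` -/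

section Group

variable (S : Set (HeightOneSpectrum (𝓞 K))) (H : Subgroup (absoluteGaloisGroup K))

/-- **`cd_p(Gal(K_Σ/L)) ≤ 2`** for `L = K̄^H`, `H` closed: `Gal(K_Σ/L) = galoisGroupAbove Σ H` is a closed subgroup of the
profinite group `G_{K,Σ}`, which has `cd_p ≤ 2` by the typed fact (Harari Cor. 17.14 / NSW (8.3.18); `Σ ⊇ {w ∣ p}`, `p ≠ 2` if
`K` has a real place), and `cd_p` does not increase on closed subgroups (Serre I Prop. 14, tree `groupCdLE_subgroup_of_isClosed_holds`).
[cite: Harari2020, Cor. 17.14 (p. 295)] [cite: NeukirchSchmidtWingberg2008, (8.3.18)] [cite: SerreGaloisCohomology1997, I §3.3 Prop. 14] -/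
theorem groupCdLE_two_galoisGroupAbove (hH : IsClosed (H : Set (absoluteGaloisGroup K)))
    (hcd : Literature.NumberTheory.GaloisCohomology.groupCdLE_two_galoisGroupUnramifiedOutside K) (p : ℕ) [Fact p.Prime]
    (hS : ∀ v : HeightOneSpectrum (𝓞 K), ((p : ℕ) : 𝓞 K) ∈ v.asIdeal → v ∈ S)
    (hreal : (∃ w : InfinitePlace K, w.IsReal) → p ≠ 2) :
    GroupCdLE (galoisGroupAbove S H) p 2 := by
  haveI : TotallyDisconnectedSpace (GaloisGroupUnramifiedOutside K S) :=
    totallyDisconnectedSpace_galoisGroupUnramifiedOutside S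
  exact groupCdLE_subgroup_of_isClosed_holds (GaloisGroupUnramifiedOutside K S) (galoisGroupAbove S H)
    (isClosed_galoisGroupAbove S H hH) p 2 (hcd S p hS hreal)

variable {M : Type} [AddCommGroup M] [DistribMulAction (absoluteGaloisGroup K) M] [TopologicalSpace M] [DiscreteTopology M]

omit [NumberField K] in
/-- **Descent of a module to `G_{K,Σ}`.** A discrete `Γ_K`-module with continuous orbit maps on which the ramification
subgroup `N_Σ` acts trivially is (uniquely) a continuous representation `ρ₀` of `G_{K,Σ} = Γ_K ⧸ N_Σ` with `ρ₀(σ̄) = σ`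
(the stabiliser of `m` in `G_{K,Σ}` is the image of its open stabiliser in `Γ_K` under the open quotient map).
[cite: NeukirchSchmidtWingberg2008, VIII §3] [cite: SerreGaloisCohomology1997, I §2.1] -/
theorem exists_continuousRep_quot (hcont : ∀ m : M, Continuous fun g : absoluteGaloisGroup K ↦ g • m)
    (htriv : ∀ σ ∈ ramificationSubgroup K S, ∀ m : M, σ • m = m) :
    ∃ ρ₀ : ContinuousRep (GaloisGroupUnramifiedOutside K S) ℤ M,
      ∀ (σ : absoluteGaloisGroup K) (m : M), ρ₀ (toUnramifiedQuot K S σ) m = σ • m := by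
  let r : Representation ℤ (absoluteGaloisGroup K) M := (discreteContRep (absoluteGaloisGroup K) M).toRepresentation
  have hr : ∀ (σ : absoluteGaloisGroup K) (m : M), r σ m = σ • m := fun _ _ ↦ rfl
  have hker : ∀ n ∈ ramificationSubgroup K S, r n = 1 := fun n hn ↦ by
    ext m
    rw [hr]
    exact htriv n hn m
  let r₀ : Representation ℤ (GaloisGroupUnramifiedOutside K S) M :=
    QuotientGroup.lift (ramificationSubgroup K S) r fun n hn ↦ hker n hn
  have hr₀ : ∀ (σ : absoluteGaloisGroup K) (m : M), r₀ (toUnramifiedQuot K S σ) m = σ • m := fun σ m ↦ by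
    change (QuotientGroup.lift (ramificationSubgroup K S) r _ (QuotientGroup.mk σ)) m = σ • m
    rw [QuotientGroup.lift_mk, hr]
  refine ⟨ContinuousRep.ofStabilizerMemNhdsOne r₀ fun m ↦ ?_, hr₀⟩
  -- the stabiliser in the quotient is the image of the open stabiliser in `Γ_K`
  have hopen : IsOpen {σ : absoluteGaloisGroup K | σ • m = m} := by
    have h := (hcont m).isOpen_preimage {m} (isOpen_discrete _)
    exact h
  have himg : toUnramifiedQuot K S '' {σ : absoluteGaloisGroup K | σ • m = m} ⊆
      {g : GaloisGroupUnramifiedOutside K S | r₀ g m = m} := by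
    rintro _ ⟨σ, hσ, rfl⟩
    change r₀ (toUnramifiedQuot K S σ) m = m
    rw [hr₀]; exact hσ
  refine Filter.mem_of_superset ((isOpenMap_toUnramifiedQuot K S _ hopen).mem_nhds ⟨1, ?_, map_one _⟩) himg
  change (1 : absoluteGaloisGroup K) • m = m
  exact one_smul _ m

variable {M' : Type} [AddCommGroup M'] [DistribMulAction (absoluteGaloisGroup K) M'] [TopologicalSpace M'] [DiscreteTopology M']

omit [NumberField K] [DiscreteTopology M] in
/-- A descended representation is determined on `Gal(K_Σ/L)` by the `Γ_K`-action: `ρ₀ g m = σ • m` for any lift `σ ∈ H` of `g`.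
[cite: NeukirchSchmidtWingberg2008, VIII §3] -/
theorem restrict_apply_of_mem (ρ₀ : ContinuousRep (GaloisGroupUnramifiedOutside K S) ℤ M)
    (hρ₀ : ∀ (σ : absoluteGaloisGroup K) (m : M), ρ₀ (toUnramifiedQuot K S σ) m = σ • m)
    (g : galoisGroupAbove S H) {σ : absoluteGaloisGroup K} (hσ : toUnramifiedQuot K S σ = g) (m : M) :
    ρ₀.restrict (galoisGroupAboveSubtype S H) g m = σ • m := by
  rw [ContinuousRep.restrict_apply, galoisGroupAboveSubtype_apply, ← hσ, hρ₀]

omit [NumberField K] in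
/-- **Descent of equivariant maps.** A `Γ_K`-equivariant additive map `j : M → M'` between descended modules is a morphism of
the restricted `Gal(K_Σ/L)`-representations. [cite: SerreGaloisCohomology1997, I §2.1] -/
theorem exists_hom_restrict (ρ₀ : ContinuousRep (GaloisGroupUnramifiedOutside K S) ℤ M)
    (ρ₀' : ContinuousRep (GaloisGroupUnramifiedOutside K S) ℤ M')
    (hρ₀ : ∀ (σ : absoluteGaloisGroup K) (m : M), ρ₀ (toUnramifiedQuot K S σ) m = σ • m)
    (hρ₀' : ∀ (σ : absoluteGaloisGroup K) (m : M'), ρ₀' (toUnramifiedQuot K S σ) m = σ • m)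
    (j : M →+ M') (hj : ∀ (σ : absoluteGaloisGroup K) (m : M), j (σ • m) = σ • j m) :
    ∃ J : (ρ₀.restrict (galoisGroupAboveSubtype S H)).toTopRep ⟶ (ρ₀'.restrict (galoisGroupAboveSubtype S H)).toTopRep,
      ∀ m : M, J.hom m = j m := by
  refine ⟨TopRep.ofHom ⟨⟨j.toIntLinearMap, continuous_of_discreteTopology⟩, fun g ↦ ?_⟩, fun _ ↦ rfl⟩
  obtain ⟨σ, -, hσ⟩ := (mem_galoisGroupAbove_iff S H g).1 g.2
  ext m
  change j (ρ₀.restrict (galoisGroupAboveSubtype S H) g m) = ρ₀'.restrict (galoisGroupAboveSubtype S H) g (j m)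
  rw [restrict_apply_of_mem S H ρ₀ hρ₀ g hσ, restrict_apply_of_mem S H ρ₀' hρ₀' g hσ, hj]

end Group

/-! ## §2 The inflation `H¹(Gal(K_Σ/L), M) → H¹(H, M)` on cocycles -/

section Inflation

variable (S : Set (HeightOneSpectrum (𝓞 K))) (H : Subgroup (absoluteGaloisGroup K))
variable {M : Type} [AddCommGroup M] [DistribMulAction (absoluteGaloisGroup K) M] [TopologicalSpace M] [DiscreteTopology M]
variable (ρ₀ : ContinuousRep (GaloisGroupUnramifiedOutside K S) ℤ M)

omit [NumberField K] in
/-- The class `h̄ ∈ Gal(K_Σ/L)` of `h ∈ H`. (Plumbing: membership of `h mod N_Σ` in `galoisGroupAbove Σ H`.) [cite: Greenberg2006, p. 342] -/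
theorem toUnramifiedQuot_mem_galoisGroupAbove (h : H) : toUnramifiedQuot K S (h : absoluteGaloisGroup K) ∈ galoisGroupAbove S H :=
  Subgroup.mem_map_of_mem _ h.2

omit [NumberField K] in
/-- **Existence of the inflation map** `infl : H¹(Gal(K_Σ/L), M) →+ H¹(H, M)`, `[φ] ↦ [h ↦ φ(h̄)]` — Mathlib's functoriality
`ContinuousCohomology.map` along `H → Gal(K_Σ/L)`, `h ↦ h̄`, with the identity of `M` — characterised on cocycles.
[cite: SerreGaloisCohomology1997, I §2.6] [cite: NeukirchSchmidtWingberg2008, (1.6.7)] -/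
theorem exists_inflation (hρ₀ : ∀ (σ : absoluteGaloisGroup K) (m : M), ρ₀ (toUnramifiedQuot K S σ) m = σ • m) :
    ∃ infl : continuousCohomology 1 (ρ₀.restrict (galoisGroupAboveSubtype S H)).toTopRep →+ subgroupH1 H M,
      ∀ (φ : contOneCocycles (ρ₀.restrict (galoisGroupAboveSubtype S H)).toTopRep)
        (ψ : contOneCocycles (discreteTopRep H M)),
        (∀ h : H, ψ.1 h = φ.1 ⟨toUnramifiedQuot K S (h : absoluteGaloisGroup K), toUnramifiedQuot_mem_galoisGroupAbove S H h⟩) →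
        infl (oneCocycleClass _ φ) = oneCocycleClass _ ψ := by
  -- the continuous homomorphism `θ : H → Gal(K_Σ/L)` and the identity of `M` over it
  let θ : H →ₜ* galoisGroupAbove S H :=
    { toFun := fun h ↦ ⟨toUnramifiedQuot K S (h : absoluteGaloisGroup K), toUnramifiedQuot_mem_galoisGroupAbove S H h⟩
      map_one' := Subtype.ext (by simp)
      map_mul' := fun a b ↦ Subtype.ext (by simp)
      continuous_toFun := ((continuous_toUnramifiedQuot K S).comp continuous_subtype_val).subtype_mk _ }
  let f : TopRep.res (θ : H →* galoisGroupAbove S H) (ρ₀.restrict (galoisGroupAboveSubtype S H)).toTopRep ⟶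
      discreteTopRep H M :=
    TopRep.ofHom ⟨ContinuousLinearMap.id ℤ M, fun h ↦ by
      ext m
      change ρ₀.restrict (galoisGroupAboveSubtype S H) (θ h) m = (h : absoluteGaloisGroup K) • m
      exact restrict_apply_of_mem S H ρ₀ hρ₀ (θ h) rfl m⟩
  refine ⟨(ContinuousCohomology.map θ f 1).hom.toLinearMap.toAddMonoidHom, fun φ ψ hψ ↦ ?_⟩
  change ContinuousCohomology.map θ f 1 (oneCocycleClass _ φ) = oneCocycleClass _ ψ
  rw [map_oneCocycleClass]
  exact congrArg _ (Subtype.ext (ContinuousMap.ext fun h ↦ (hψ h).symm))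

variable {S H ρ₀}

omit [NumberField K] in
/-- Every cocycle of `Gal(K_Σ/L)` has an inflated cocycle on `H` (its composite with `h ↦ h̄`). [cite: SerreGaloisCohomology1997, I §2.6] -/
theorem exists_cocycle_inflate (hρ₀ : ∀ (σ : absoluteGaloisGroup K) (m : M), ρ₀ (toUnramifiedQuot K S σ) m = σ • m)
    (φ : contOneCocycles (ρ₀.restrict (galoisGroupAboveSubtype S H)).toTopRep) :
    ∃ ψ : contOneCocycles (discreteTopRep H M),
      ∀ h : H, ψ.1 h = φ.1 ⟨toUnramifiedQuot K S (h : absoluteGaloisGroup K), toUnramifiedQuot_mem_galoisGroupAbove S H h⟩ := by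
  refine ⟨⟨⟨fun h ↦ φ.1 ⟨toUnramifiedQuot K S (h : absoluteGaloisGroup K), toUnramifiedQuot_mem_galoisGroupAbove S H h⟩,
    φ.1.continuous.comp (((continuous_toUnramifiedQuot K S).comp continuous_subtype_val).subtype_mk _)⟩, fun a b ↦ ?_⟩,
    fun _ ↦ rfl⟩
  have hab : (⟨toUnramifiedQuot K S ((a * b : H) : absoluteGaloisGroup K), toUnramifiedQuot_mem_galoisGroupAbove S H (a * b)⟩ :
      galoisGroupAbove S H) =
      ⟨toUnramifiedQuot K S (a : absoluteGaloisGroup K), toUnramifiedQuot_mem_galoisGroupAbove S H a⟩ *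
        ⟨toUnramifiedQuot K S (b : absoluteGaloisGroup K), toUnramifiedQuot_mem_galoisGroupAbove S H b⟩ :=
    Subtype.ext (by simp)
  change φ.1 _ = φ.1 _ + (a : absoluteGaloisGroup K) • φ.1 _
  rw [hab, φ.2, ContinuousRep.toTopRep_ρ_apply,
    restrict_apply_of_mem S H ρ₀ hρ₀ _ (rfl : toUnramifiedQuot K S (a : absoluteGaloisGroup K) = _)]

omit [NumberField K] in
/-- **Inflation is injective** (a cocycle of `Gal(K_Σ/L)` whose inflation is principal is principal with the same element,
`H → Gal(K_Σ/L)` being onto). [cite: SerreGaloisCohomology1997, I §2.6 (b)] -/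
theorem inflation_injective (hρ₀ : ∀ (σ : absoluteGaloisGroup K) (m : M), ρ₀ (toUnramifiedQuot K S σ) m = σ • m)
    (infl : continuousCohomology 1 (ρ₀.restrict (galoisGroupAboveSubtype S H)).toTopRep →+ subgroupH1 H M)
    (hinfl : ∀ (φ : contOneCocycles (ρ₀.restrict (galoisGroupAboveSubtype S H)).toTopRep)
        (ψ : contOneCocycles (discreteTopRep H M)),
        (∀ h : H, ψ.1 h = φ.1 ⟨toUnramifiedQuot K S (h : absoluteGaloisGroup K), toUnramifiedQuot_mem_galoisGroupAbove S H h⟩) →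
        infl (oneCocycleClass _ φ) = oneCocycleClass _ ψ) :
    Injective infl := by
  refine (injective_iff_map_eq_zero infl).2 fun x hx ↦ ?_
  obtain ⟨φ, rfl⟩ := oneCocycleClass_surjective _ x
  obtain ⟨ψ, hψ⟩ := exists_cocycle_inflate hρ₀ φ
  rw [hinfl φ ψ hψ, oneCocycleClass_eq_zero_iff] at hx
  obtain ⟨a, ha⟩ := hx
  rw [oneCocycleClass_eq_zero_iff]
  refine ⟨a, fun g ↦ ?_⟩
  obtain ⟨σ, hσH, hσ⟩ := (mem_galoisGroupAbove_iff S H g).1 g.2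
  have hg : g = ⟨toUnramifiedQuot K S ((⟨σ, hσH⟩ : H) : absoluteGaloisGroup K), toUnramifiedQuot_mem_galoisGroupAbove S H _⟩ :=
    Subtype.ext hσ.symm
  have h1 := ha ⟨σ, hσH⟩
  rw [hψ] at h1
  rw [hg, h1, ContinuousRep.toTopRep_ρ_apply, restrict_apply_of_mem S H ρ₀ hρ₀ _ rfl]
  rfl

omit [NumberField K] in
/-- **A cocycle of `H` vanishing on `N_Σ` descends continuously to `Gal(K_Σ/L)`** (`H` closed, `N_Σ ≤ H`): well defined since two
lifts differ by `N_Σ` (where the cocycle vanishes and which acts trivially), continuous since `H ↠ Gal(K_Σ/L)` is a quotient map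
(continuous surjection from a compact space to a Hausdorff space). The one-`H` version of
`GreenbergFullAtSelmer.exists_cocycle_descent`. [cite: NeukirchSchmidtWingberg2008, (1.6.7), VIII §3] -/
theorem exists_cocycle_descend (hH : IsClosed (H : Set (absoluteGaloisGroup K))) (hNH : ramificationSubgroup K S ≤ H)
    (hρ₀ : ∀ (σ : absoluteGaloisGroup K) (m : M), ρ₀ (toUnramifiedQuot K S σ) m = σ • m)
    (ψ : contOneCocycles (discreteTopRep H M)) (hψ : ∀ (n : absoluteGaloisGroup K) (hn : n ∈ ramificationSubgroup K S), ψ.1 ⟨n, hNH hn⟩ = 0) :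
    ∃ φ : contOneCocycles (ρ₀.restrict (galoisGroupAboveSubtype S H)).toTopRep,
      ∀ h : H, ψ.1 h = φ.1 ⟨toUnramifiedQuot K S (h : absoluteGaloisGroup K), toUnramifiedQuot_mem_galoisGroupAbove S H h⟩ := by
  haveI : CompactSpace (absoluteGaloisGroup K) := absoluteGaloisGroup_compactSpace K
  haveI : CompactSpace H := isCompact_iff_compactSpace.mp hH.isCompact
  -- the projection `q : H → Gal(K_Σ/L)`, a quotient map
  let q : H → galoisGroupAbove S H := fun h ↦
    ⟨toUnramifiedQuot K S (h : absoluteGaloisGroup K), toUnramifiedQuot_mem_galoisGroupAbove S H h⟩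
  have hqc : Continuous q := ((continuous_toUnramifiedQuot K S).comp continuous_subtype_val).subtype_mk _
  have hqs : Surjective q := fun g ↦ by
    obtain ⟨σ, hσH, hσ⟩ := (mem_galoisGroupAbove_iff S H g).1 g.2
    exact ⟨⟨σ, hσH⟩, Subtype.ext hσ⟩
  have hq : IsQuotientMap q := hqc.isClosedMap.isQuotientMap hqc hqs
  -- two lifts give the same value of `ψ`
  have hwd : ∀ s t : H, q s = q t → ψ.1 s = ψ.1 t := by
    intro s t hst
    have hn : (s : absoluteGaloisGroup K)⁻¹ * (t : absoluteGaloisGroup K) ∈ ramificationSubgroup K S :=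
      QuotientGroup.eq.mp (congrArg Subtype.val hst)
    have heq : t = s * ⟨(s : absoluteGaloisGroup K)⁻¹ * t, hNH hn⟩ := Subtype.ext (by simp [mul_inv_cancel_left])
    rw [heq, ψ.2, hψ _ hn, map_zero, add_zero]
  -- the descended function
  let φf : galoisGroupAbove S H → M := fun g ↦ ψ.1 (Classical.choose (hqs g))
  have hφf : ∀ h : H, φf (q h) = ψ.1 h := fun h ↦ hwd _ _ (Classical.choose_spec (hqs (q h)))
  have hφc : Continuous φf := by
    refine hq.continuous_iff.mpr ?_
    have hcomp : φf ∘ q = fun h ↦ ψ.1 h := funext fun h ↦ hφf h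
    rw [hcomp]
    exact ψ.1.continuous
  refine ⟨⟨⟨φf, hφc⟩, fun g₁ g₂ ↦ ?_⟩, fun h ↦ (hφf h).symm⟩
  obtain ⟨h₁, rfl⟩ := hqs g₁
  obtain ⟨h₂, rfl⟩ := hqs g₂
  have hmul : q h₁ * q h₂ = q (h₁ * h₂) := Subtype.ext (by simp [q])
  change φf (q h₁ * q h₂) = φf (q h₁) + ρ₀.restrict (galoisGroupAboveSubtype S H) (q h₁) (φf (q h₂))
  rw [hmul, hφf, hφf, hφf, ψ.2, restrict_apply_of_mem S H ρ₀ hρ₀ (q h₁) rfl]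
  rfl

omit [NumberField K] in
/-- **The range of inflation is the kernel of restriction to `N_Σ`** (inflation–restriction in degree `1` for
`1 → N_Σ/… → H → Gal(K_Σ/L) → 1`, with `N_Σ` acting trivially on `M`). [cite: SerreGaloisCohomology1997, I §2.6 (b)]
[cite: NeukirchSchmidtWingberg2008, (1.6.7)] -/
theorem range_inflation_eq_ker_resOfLe (hH : IsClosed (H : Set (absoluteGaloisGroup K))) (hNH : ramificationSubgroup K S ≤ H)
    (hρ₀ : ∀ (σ : absoluteGaloisGroup K) (m : M), ρ₀ (toUnramifiedQuot K S σ) m = σ • m)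
    (infl : continuousCohomology 1 (ρ₀.restrict (galoisGroupAboveSubtype S H)).toTopRep →+ subgroupH1 H M)
    (hinfl : ∀ (φ : contOneCocycles (ρ₀.restrict (galoisGroupAboveSubtype S H)).toTopRep)
        (ψ : contOneCocycles (discreteTopRep H M)),
        (∀ h : H, ψ.1 h = φ.1 ⟨toUnramifiedQuot K S (h : absoluteGaloisGroup K), toUnramifiedQuot_mem_galoisGroupAbove S H h⟩) →
        infl (oneCocycleClass _ φ) = oneCocycleClass _ ψ) :
    infl.range = (resOfLe M hNH).ker := by
  have htriv : ∀ σ ∈ ramificationSubgroup K S, ∀ m : M, σ • m = m := fun σ hσ m ↦ by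
    have h1 : toUnramifiedQuot K S σ = 1 := (QuotientGroup.eq_one_iff σ).mpr hσ
    rw [← hρ₀, h1, map_one]
    rfl
  ext c
  constructor
  · rintro ⟨x, rfl⟩
    obtain ⟨φ, rfl⟩ := oneCocycleClass_surjective _ x
    obtain ⟨ψ, hψ⟩ := exists_cocycle_inflate hρ₀ φ
    rw [AddMonoidHom.mem_ker, hinfl φ ψ hψ, resOfLe, resH1Hom_oneCocycleClass, oneCocycleClass_eq_zero_iff]
    refine ⟨0, fun n ↦ ?_⟩
    rw [pullback_resHomOfEquivariant_apply, AddMonoidHom.id_apply, map_zero, sub_zero, hψ]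
    have h1 : (⟨toUnramifiedQuot K S ((subgroupInclusion hNH n : H) : absoluteGaloisGroup K),
        toUnramifiedQuot_mem_galoisGroupAbove S H _⟩ : galoisGroupAbove S H) = 1 :=
      Subtype.ext ((QuotientGroup.eq_one_iff _).mpr n.2)
    rw [h1]
    exact contOneCocycles.apply_one φ
  · intro hc
    obtain ⟨ψ, rfl⟩ := oneCocycleClass_surjective _ c
    rw [AddMonoidHom.mem_ker, resOfLe, resH1Hom_oneCocycleClass, oneCocycleClass_eq_zero_iff] at hc
    obtain ⟨a, ha⟩ := hc
    have hψ0 : ∀ (n : absoluteGaloisGroup K) (hn : n ∈ ramificationSubgroup K S), ψ.1 ⟨n, hNH hn⟩ = 0 := by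
      intro n hn
      have h := ha ⟨n, hn⟩
      rw [pullback_resHomOfEquivariant_apply, AddMonoidHom.id_apply] at h
      have h' : ψ.1 ⟨n, hNH hn⟩ = n • a - a := h
      rw [h', htriv n hn a, sub_self]
    obtain ⟨φ, hφ⟩ := exists_cocycle_descend hH hNH hρ₀ ψ hψ0
    exact ⟨oneCocycleClass _ φ, hinfl φ ψ hφ⟩

variable {M' : Type} [AddCommGroup M'] [DistribMulAction (absoluteGaloisGroup K) M'] [TopologicalSpace M'] [DiscreteTopology M']
variable {ρ₀' : ContinuousRep (GaloisGroupUnramifiedOutside K S) ℤ M'}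

omit [NumberField K] in
/-- **Naturality of inflation** in the module: for a `Γ_K`-equivariant `j : M → M'` and a morphism `J` of the restricted
`Gal(K_Σ/L)`-representations acting as `j`, `infl' ∘ H¹(J) = j_* ∘ infl`. [cite: SerreGaloisCohomology1997, I §2.4–2.6] -/
theorem inflation_natural (hρ₀ : ∀ (σ : absoluteGaloisGroup K) (m : M), ρ₀ (toUnramifiedQuot K S σ) m = σ • m)
    (infl : continuousCohomology 1 (ρ₀.restrict (galoisGroupAboveSubtype S H)).toTopRep →+ subgroupH1 H M)
    (hinfl : ∀ (φ : contOneCocycles (ρ₀.restrict (galoisGroupAboveSubtype S H)).toTopRep)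
        (ψ : contOneCocycles (discreteTopRep H M)),
        (∀ h : H, ψ.1 h = φ.1 ⟨toUnramifiedQuot K S (h : absoluteGaloisGroup K), toUnramifiedQuot_mem_galoisGroupAbove S H h⟩) →
        infl (oneCocycleClass _ φ) = oneCocycleClass _ ψ)
    (infl' : continuousCohomology 1 (ρ₀'.restrict (galoisGroupAboveSubtype S H)).toTopRep →+ subgroupH1 H M')
    (hinfl' : ∀ (φ : contOneCocycles (ρ₀'.restrict (galoisGroupAboveSubtype S H)).toTopRep)
        (ψ : contOneCocycles (discreteTopRep H M')),
        (∀ h : H, ψ.1 h = φ.1 ⟨toUnramifiedQuot K S (h : absoluteGaloisGroup K), toUnramifiedQuot_mem_galoisGroupAbove S H h⟩) →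
        infl' (oneCocycleClass _ φ) = oneCocycleClass _ ψ)
    (j : M →+ M') (hj : ∀ (σ : absoluteGaloisGroup K) (m : M), j (σ • m) = σ • j m)
    (J : (ρ₀.restrict (galoisGroupAboveSubtype S H)).toTopRep ⟶ (ρ₀'.restrict (galoisGroupAboveSubtype S H)).toTopRep)
    (hJ : ∀ m : M, J.hom m = j m) (x : continuousCohomology 1 (ρ₀.restrict (galoisGroupAboveSubtype S H)).toTopRep) :
    infl' (cohomologyMap J 1 x) = resH1Hom (ContinuousMonoidHom.id H) j (fun g m ↦ hj (g : absoluteGaloisGroup K) m) (infl x) := by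
  obtain ⟨φ, rfl⟩ := oneCocycleClass_surjective _ x
  obtain ⟨ψ, hψ⟩ := exists_cocycle_inflate hρ₀ φ
  rw [hinfl φ ψ hψ, cohomologyMap_oneCocycleClass, resH1Hom_oneCocycleClass]
  refine hinfl' _ _ fun h ↦ ?_
  rw [pullback_resHomOfEquivariant_apply, pullback_id_resIdHom_apply, hJ, hψ]
  rfl

end Inflation

/-! ## §3 The additive equivalence `H¹(Gal(K_Σ/L), M) ≃+ unramifiedOutside H M p S₀` -/

section Equiv

variable (H : Subgroup (absoluteGaloisGroup K)) [H.Normal] (p : ℕ) (S₀ : Set (HeightOneSpectrum (𝓞 K)))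
variable {M : Type} [AddCommGroup M] [DistribMulAction (absoluteGaloisGroup K) M] [TopologicalSpace M] [DiscreteTopology M]
variable (ρ₀ : ContinuousRep (GaloisGroupUnramifiedOutside K (S₀ ∪ {v | ((p : ℕ) : 𝓞 K) ∈ v.asIdeal})) ℤ M)

/-- **`H¹(Gal(K_Σ/L), M) ≃+ unramifiedOutside H M p S₀`**, `Σ = S₀ ∪ {w ∣ p}`, `L = K̄^H` (`H ⊴ Γ_K` closed, `N_Σ ≤ H`), for a
discrete `Γ_K`-module descended to `G_{K,Σ}` — Greenberg–Vatsal's "`H¹(K_Σ/K_∞, A)`" place by place IS the cohomology of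
`Gal(K_Σ/K_∞)`; the equivalence is inflation, characterised on cocycles by `e [φ] = [h ↦ φ(h̄)]`.
[cite: GreenbergVatsal2000, §2 pp. 16–17, 23] [cite: SerreGaloisCohomology1997, I §2.6 (b)] [cite: Greenberg2006, p. 342] -/
theorem exists_addEquiv_unramifiedOutside (hH : IsClosed (H : Set (absoluteGaloisGroup K)))
    (hNH : ramificationSubgroup K (S₀ ∪ {v | ((p : ℕ) : 𝓞 K) ∈ v.asIdeal}) ≤ H)
    (hρ₀ : ∀ (σ : absoluteGaloisGroup K) (m : M), ρ₀ (toUnramifiedQuot K _ σ) m = σ • m) :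
    ∃ e : continuousCohomology 1 (ρ₀.restrict (galoisGroupAboveSubtype _ H)).toTopRep ≃+ unramifiedOutside H M p S₀,
      ∀ (φ : contOneCocycles (ρ₀.restrict (galoisGroupAboveSubtype _ H)).toTopRep) (ψ : contOneCocycles (discreteTopRep H M)),
        (∀ h : H, ψ.1 h = φ.1 ⟨toUnramifiedQuot K _ (h : absoluteGaloisGroup K), toUnramifiedQuot_mem_galoisGroupAbove _ H h⟩) →
        ((e (oneCocycleClass _ φ) : unramifiedOutside H M p S₀) : subgroupH1 H M) = oneCocycleClass _ ψ := by
  obtain ⟨infl, hinfl⟩ := exists_inflation _ H ρ₀ hρ₀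
  have hinj := inflation_injective hρ₀ infl hinfl
  have htriv : ∀ σ ∈ ramificationSubgroup K (S₀ ∪ {v | ((p : ℕ) : 𝓞 K) ∈ v.asIdeal}), ∀ m : M, σ • m = m := fun σ hσ m ↦ by
    have h1 : toUnramifiedQuot K (S₀ ∪ {v | ((p : ℕ) : 𝓞 K) ∈ v.asIdeal}) σ = 1 := (QuotientGroup.eq_one_iff σ).mpr hσ
    rw [← hρ₀, h1, map_one]
    rfl
  have hrange : infl.range = unramifiedOutside H M p S₀ := by
    rw [range_inflation_eq_ker_resOfLe hH hNH hρ₀ infl hinfl, unramifiedOutside_eq_ker_resOfLe hH hNH htriv]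
  let e₁ : continuousCohomology 1 (ρ₀.restrict (galoisGroupAboveSubtype _ H)).toTopRep ≃+ infl.range :=
    AddMonoidHom.ofInjective hinj
  refine ⟨e₁.trans (AddEquiv.addSubgroupCongr hrange), fun φ ψ hψ ↦ ?_⟩
  rw [← hinfl φ ψ hψ]
  rfl

end Equiv

end Summit.BirchSwinnertonDyer.BirchSwinnertonDyer.Theorems.UnramifiedInflation

end
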